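import Summits.AnomalousDissipation.AnomalousDissipation.Theorems.SolenoidalFractalHomogenisationRealisedQuasiStaticCellLawIsoSectorDecayComoving
import Summits.AnomalousDissipation.AnomalousDissipation.Theorems.SolenoidalFractalHomogenisationRealisedQuasiStaticCellLawIsoMuLower
import Summits.AnomalousDissipation.AnomalousDissipation.Theorems.SolenoidalFractalHomogenisationRealisedQuasiStaticCellLawIsoIsotropySumWord
import Summits.AnomalousDissipation.AnomalousDissipation.Theorems.SolenoidalFractalHomogenisationRealisedQuasiStaticCellLawAnySlotInputs
import Summits.AnomalousDissipation.AnomalousDissipation.Theorems.SolenoidalFractalHomogenisationRealisedQuasiStaticCellLawWeakArithmetic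
import Summits.AnomalousDissipation.AnomalousDissipation.Theorems.SolenoidalFractalHomogenisationRealisedQuasiStaticCellLawInPlaneWeightLower
import Summits.AnomalousDissipation.AnomalousDissipation.Theorems.SolenoidalFractalHomogenisationRealisedQuasiStaticCellLawInPlaneFloorDefect
import Summits.AnomalousDissipation.AnomalousDissipation.Theorems.SolenoidalFractalHomogenisationRealisedQuasiStaticCellLawCouplingAlgebra
import HarnessLib

/-!
# K2R `RealisedQuasiStaticCellLaw`, line `floquet-bloch`, stub `stub_lowSectorWeakNear`: decay of a weakly coupled low sector
# by the CO-MOVING (isotropic pair) road, modulo scalar inequalities (helper; `--supports stmt-AnomalousDissipation-20446`)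

Summits-side helper file (everything proved; no definitions, no named facts). The W-near analogue of `weakSector_decay_of_rates`
(p588172): for an ISOTROPIC word (`IsotropicWordGain W c₀`), a sector `ℓ ≠ 0` with `4‖ℓ‖ ≤ ‖K_j‖`, `2‖ℓ‖ ≤ n`, the frames of
`anySlot_inputs`, the slaving weights (`slaving_weight_bounds`, `outPlane_weight_ge_two`, `inPlane_weight_lower`,
`inPlane_floor_defect`), the isotropy bound `μ` (`iso_mu_lower` + `iso_isotropy_sum_word` + `slot_exponent_eq_slotWeight`) and
the co-moving assembly `isoSector_decay_comoving` (p594449) give: every weak solution from the sector satisfies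
`∫‖w(t)‖² ≤ β e^{2(1−2ε)λP} e^{−2(1−2ε)λt} ∫‖w₀‖²` a.e., under frame-free scalar hypotheses only (`isoSector_decay_of_rates`).
-/

set_option linter.dupNamespace false

noncomputable section

namespace Summit.AnomalousDissipation.AnomalousDissipation.Theorems.SolenoidalFractalHomogenisation.RealisedQuasiStaticCellLaw

open Set MeasureTheory Filter Topology Function Matrix
open scoped InnerProductSpace ComplexConjugate Matrix
open Literature.Analysis Literature.Analysis.FunctionSpaces Literature.Analysis.FunctionSpaces.Torus
open Literature.Analysis.FluidPDE Literature.Analysis.FluidPDE.LatticeShear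

variable {k₀ : ℕ}

set_option maxHeartbeats 1600000 in
/-- **Co-moving (W-near) decay at a target rate, modulo scalar inequalities.** -/
theorem isoSector_decay_of_rates (W : LatticeWord k₀) {c₀ : ℝ} (hW : IsotropicWordGain W c₀) {n : ℕ} (hn : 0 < n)
    {κ : ℝ} (hκ : 0 < κ)
    (ℓ : Fin 3 → ℤ) (hℓ : ℓ ≠ 0) (hℓn : 2 * ‖latticeVec ℓ‖ ≤ n) {w₀ : UnitAddTorus (Fin 3) → EuclideanSpace ℝ (Fin 3)}
    (hw₀ : FunctionSpaces.Torus.MemSobolev 1 (FunctionSpaces.EuclideanSpace.complexify ∘ w₀))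
    (hdiv : FunctionSpaces.Torus.IsWeaklyDivFree w₀) (hmean : FunctionSpaces.Torus.HasZeroMean w₀)
    (hsupp : ∀ k : Fin 3 → ℤ, ¬ ((∃ z : Fin 3 → ℤ, k = ℓ + (n:ℤ) • z) ∨ (∃ z : Fin 3 → ℤ, k = -ℓ + (n:ℤ) • z)) →
      UnitAddTorus.mFourierCoeff (FunctionSpaces.EuclideanSpace.complexify ∘ w₀) k = 0)
    (h4 : ∀ j : Fin k₀, 4 * ‖latticeVec ℓ‖ ≤ ‖latticeVec (fun i => (W.phase j).m i * (n : ℤ))‖)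
    {ε β lam : ℝ} (hε : 0 ≤ ε) (hε2 : ε ≤ 1 / 2) (hβ : 1 ≤ β) (hlam : 0 ≤ lam)
    (hsmall : ∀ j : Fin k₀, (2 * Real.pi * (∑ i, (W.phase j).e i * (ℓ i : ℝ)) * ‖Complex.exp ((W.phase j).φ * Complex.I) * (1 / (2 * ((2 * Real.pi * ‖latticeVec (W.phase j).m‖ : ℝ) : ℂ) * Complex.I))‖ * (1 / (n : ℝ)) / (κ * (4 * Real.pi ^ 2 * freqNormSq (fun i => (W.phase j).m i * (n : ℤ))))) ^ 2 * (4 * 2 / (7 / 16)) + 2 * lam / (κ * (4 * Real.pi ^ 2 * freqNormSq (fun i => (W.phase j).m i * (n : ℤ)))) ≤ 7 / 16)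
    (hβ' : ∀ j : Fin k₀, 16 * Real.exp (4 * (∑ j : Fin k₀, ((κ * (4 * Real.pi ^ 2 * freqNormSq (fun i => (W.phase j).m i * (n : ℤ)))) * ((freqNormSq ℓ / freqNormSq (fun i => (W.phase j).m i * (n : ℤ))) * (W.phase j).τ + 32 / 7 * (2 * Real.pi * (∑ i, (W.phase j).e i * (ℓ i : ℝ)) * ‖Complex.exp ((W.phase j).φ * Complex.I) * (1 / (2 * ((2 * Real.pi * ‖latticeVec (W.phase j).m‖ : ℝ) : ℂ) * Complex.I))‖ * (1 / (n : ℝ)) / (κ * (4 * Real.pi ^ 2 * freqNormSq (fun i => (W.phase j).m i * (n : ℤ))))) ^ 2 * ((W.phase j).τ * (1 - 4 * W.ramp / 3))) + (κ * (4 * Real.pi ^ 2 * freqNormSq (fun i => (W.phase j).m i * (n : ℤ)))) * ((freqNormSq ℓ / freqNormSq (fun i => (W.phase j).m i * (n : ℤ))) * (W.phase j).τ + 32 / 7 * (2 * Real.pi * (∑ i, (W.phase j).e i * (ℓ i : ℝ)) * ‖Complex.exp ((W.phase j).φ * Complex.I) * (1 / (2 * ((2 * Real.pi * ‖latticeVec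 (W.phase j).m‖ : ℝ) : ℂ) * Complex.I))‖ * (1 / (n : ℝ)) / (κ * (4 * Real.pi ^ 2 * freqNormSq (fun i => (W.phase j).m i * (n : ℤ))))) ^ 2 * ((W.phase j).τ * (1 - 4 * W.ramp / 3)))))) ^ 2 * (2 * Real.pi * (∑ i, (W.phase j).e i * (ℓ i : ℝ)) * ‖Complex.exp ((W.phase j).φ * Complex.I) * (1 / (2 * ((2 * Real.pi * ‖latticeVec (W.phase j).m‖ : ℝ) : ℂ) * Complex.I))‖ * (1 / (n : ℝ)) / (κ * (4 * Real.pi ^ 2 * freqNormSq (fun i => (W.phase j).m i * (n : ℤ))))) ^ 2 * (κ * (4 * Real.pi ^ 2 * freqNormSq (fun i => (W.phase j).m i * (n : ℤ)))) * 2 ≤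
      Real.exp (-(2 * lam * W.period)) * ε * lam * β * (7 / 16))
    (hJ : ∀ j : Fin k₀, ((40 * β * 2 * (κ * (4 * Real.pi ^ 2 * freqNormSq (fun i => (W.phase j).m i * (n : ℤ)))) * (W.phase j).τ * (2 * Real.pi * (∑ i, (W.phase j).e i * (ℓ i : ℝ)) * ‖Complex.exp ((W.phase j).φ * Complex.I) * (1 / (2 * ((2 * Real.pi * ‖latticeVec (W.phase j).m‖ : ℝ) : ℂ) * Complex.I))‖ * (1 / (n : ℝ)) / (κ * (4 * Real.pi ^ 2 * freqNormSq (fun i => (W.phase j).m i * (n : ℤ))))) ^ 4 * (1 + (2 * Real.pi * (∑ i, (W.phase j).e i * (ℓ i : ℝ)) * ‖Complex.exp ((W.phase j).φ * Complex.I) * (1 / (2 * ((2 * Real.pi * ‖latticeVec (W.phase j).m‖ : ℝ) : ℂ) * Complex.I))‖ * (1 / (n : ℝ)) / (κ * (4 * Real.pi ^ 2 * freqNormSq (fun i => (W.phase j).m i * (n : ℤ))))) ^ 2 * (32 / 7) ^ 2) / (7 / 16) ^ 3 + 48 * β * 2 * (2 * Real.pi * (∑ i, (W.phase j).e i * (ℓ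 i : ℝ)) * ‖Complex.exp ((W.phase j).φ * Complex.I) * (1 / (2 * ((2 * Real.pi * ‖latticeVec (W.phase j).m‖ : ℝ) : ℂ) * Complex.I))‖ * (1 / (n : ℝ)) / (κ * (4 * Real.pi ^ 2 * freqNormSq (fun i => (W.phase j).m i * (n : ℤ))))) ^ 2 / (W.ramp * (W.phase j).τ * (κ * (4 * Real.pi ^ 2 * freqNormSq (fun i => (W.phase j).m i * (n : ℤ)))) * (7 / 16) ^ 3)) / Real.exp (-(2 * lam * W.period))) ≤ 2 * ε * (lam * (W.phase j).τ))
    (hF : ∀ j : Fin k₀, 2 * (1 - 2 * ε) * (lam * (W.phase j).τ) ≤ 8 * Real.pi ^ 2 * κ * ((n : ℝ) / 2) ^ 2 * (W.phase j).τ)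
    (hSY : (∑ j : Fin k₀, (Real.exp ((κ * (4 * Real.pi ^ 2 * freqNormSq (fun i => (W.phase j).m i * (n : ℤ)))) * ((freqNormSq ℓ / freqNormSq (fun i => (W.phase j).m i * (n : ℤ))) * (W.phase j).τ + 32 / 7 * (2 * Real.pi * (∑ i, (W.phase j).e i * (ℓ i : ℝ)) * ‖Complex.exp ((W.phase j).φ * Complex.I) * (1 / (2 * ((2 * Real.pi * ‖latticeVec (W.phase j).m‖ : ℝ) : ℂ) * Complex.I))‖ * (1 / (n : ℝ)) / (κ * (4 * Real.pi ^ 2 * freqNormSq (fun i => (W.phase j).m i * (n : ℤ))))) ^ 2 * ((W.phase j).τ * (1 - 4 * W.ramp / 3))) + (κ * (4 * Real.pi ^ 2 * freqNormSq (fun i => (W.phase j).m i * (n : ℤ)))) * ((freqNormSq ℓ / freqNormSq (fun i => (W.phase j).m i * (n : ℤ))) * (W.phase j).τ + 32 / 7 * (2 * Real.pi * (∑ i, (W.phase j).e i * (ℓ i : ℝ)) * ‖Complex.exp ((W.phase j).φ * Complex.I) * (1 / (2 * ((2 * Real.pi * ‖latticeVec (W.phase j).m‖ : ℝ) : ℂ)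 * Complex.I))‖ * (1 / (n : ℝ)) / (κ * (4 * Real.pi ^ 2 * freqNormSq (fun i => (W.phase j).m i * (n : ℤ))))) ^ 2 * ((W.phase j).τ * (1 - 4 * W.ramp / 3)))) - 1)) ≤ 1) (hposY : 0 ≤ 1 + ((∑ j : Fin k₀, (κ * (4 * Real.pi ^ 2 * freqNormSq (fun i => (W.phase j).m i * (n : ℤ)))) * (freqNormSq ℓ / freqNormSq (fun i => (W.phase j).m i * (n : ℤ))) * (W.phase j).τ) + (1 - 4 * W.ramp / 3) * 1 * (2 * (2 * Real.pi ^ 2 / (κ * (n : ℝ) ^ 4) * (c₀ * W.period * ‖latticeVec ℓ‖ ^ 2)) - 12 * ‖latticeVec ℓ‖ / (n : ℝ) * ∑ j : Fin k₀, ((κ * (4 * Real.pi ^ 2 * freqNormSq (fun i => (W.phase j).m i * (n : ℤ)))) * (W.phase j).τ * (2 * Real.pi * (∑ i, (W.phase j).e i * (ℓ i : ℝ)) * ‖Complex.exp ((W.phase j).φ * Complex.I) * (1 / (2 * ((2 * Real.pi * ‖latticeVec (W.phase j).m‖ : ℝ) : ℂ) * Complex.I))‖ * (1 / (n : ℝ))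 / (κ * (4 * Real.pi ^ 2 * freqNormSq (fun i => (W.phase j).m i * (n : ℤ))))) ^ 2))) - (∑ j : Fin k₀, (Real.exp ((κ * (4 * Real.pi ^ 2 * freqNormSq (fun i => (W.phase j).m i * (n : ℤ)))) * ((freqNormSq ℓ / freqNormSq (fun i => (W.phase j).m i * (n : ℤ))) * (W.phase j).τ + 32 / 7 * (2 * Real.pi * (∑ i, (W.phase j).e i * (ℓ i : ℝ)) * ‖Complex.exp ((W.phase j).φ * Complex.I) * (1 / (2 * ((2 * Real.pi * ‖latticeVec (W.phase j).m‖ : ℝ) : ℂ) * Complex.I))‖ * (1 / (n : ℝ)) / (κ * (4 * Real.pi ^ 2 * freqNormSq (fun i => (W.phase j).m i * (n : ℤ))))) ^ 2 * ((W.phase j).τ * (1 - 4 * W.ramp / 3))) + (κ * (4 * Real.pi ^ 2 * freqNormSq (fun i => (W.phase j).m i * (n : ℤ)))) * ((freqNormSq ℓ / freqNormSq (fun i => (W.phase j).m i * (n : ℤ))) * (W.phase j).τ + 32 / 7 * (2 * Real.pi * (∑ i, (W.phase j).e i * (ℓ i : ℝ)) * ‖Complex.exp ((W.phase j).φ * Complex.I)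 * (1 / (2 * ((2 * Real.pi * ‖latticeVec (W.phase j).m‖ : ℝ) : ℂ) * Complex.I))‖ * (1 / (n : ℝ)) / (κ * (4 * Real.pi ^ 2 * freqNormSq (fun i => (W.phase j).m i * (n : ℤ))))) ^ 2 * ((W.phase j).τ * (1 - 4 * W.ramp / 3)))) - 1)) ^ 2)
    (hlamY : Real.exp (2 * lam * W.period) ≤ (1 + ((∑ j : Fin k₀, (κ * (4 * Real.pi ^ 2 * freqNormSq (fun i => (W.phase j).m i * (n : ℤ)))) * (freqNormSq ℓ / freqNormSq (fun i => (W.phase j).m i * (n : ℤ))) * (W.phase j).τ) + (1 - 4 * W.ramp / 3) * 1 * (2 * (2 * Real.pi ^ 2 / (κ * (n : ℝ) ^ 4) * (c₀ * W.period * ‖latticeVec ℓ‖ ^ 2)) - 12 * ‖latticeVec ℓ‖ / (n : ℝ) * ∑ j : Fin k₀, ((κ * (4 * Real.pi ^ 2 * freqNormSq (fun i => (W.phase j).m i * (n : ℤ)))) * (W.phase j).τ * (2 * Real.pi * (∑ i, (W.phase j).e i * (ℓ i : ℝ)) * ‖Complex.exp ((W.phase j).φ * Complex.I) * (1 / (2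 * ((2 * Real.pi * ‖latticeVec (W.phase j).m‖ : ℝ) : ℂ) * Complex.I))‖ * (1 / (n : ℝ)) / (κ * (4 * Real.pi ^ 2 * freqNormSq (fun i => (W.phase j).m i * (n : ℤ))))) ^ 2))) - (∑ j : Fin k₀, (Real.exp ((κ * (4 * Real.pi ^ 2 * freqNormSq (fun i => (W.phase j).m i * (n : ℤ)))) * ((freqNormSq ℓ / freqNormSq (fun i => (W.phase j).m i * (n : ℤ))) * (W.phase j).τ + 32 / 7 * (2 * Real.pi * (∑ i, (W.phase j).e i * (ℓ i : ℝ)) * ‖Complex.exp ((W.phase j).φ * Complex.I) * (1 / (2 * ((2 * Real.pi * ‖latticeVec (W.phase j).m‖ : ℝ) : ℂ) * Complex.I))‖ * (1 / (n : ℝ)) / (κ * (4 * Real.pi ^ 2 * freqNormSq (fun i => (W.phase j).m i * (n : ℤ))))) ^ 2 * ((W.phase j).τ * (1 - 4 * W.ramp / 3))) + (κ * (4 * Real.pi ^ 2 * freqNormSq (fun i => (W.phase j).m i * (n : ℤ)))) * ((freqNormSq ℓ / freqNormSq (fun i => (W.phase j).m i * (n : ℤ))) * (W.phase j).τ + 32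 / 7 * (2 * Real.pi * (∑ i, (W.phase j).e i * (ℓ i : ℝ)) * ‖Complex.exp ((W.phase j).φ * Complex.I) * (1 / (2 * ((2 * Real.pi * ‖latticeVec (W.phase j).m‖ : ℝ) : ℂ) * Complex.I))‖ * (1 / (n : ℝ)) / (κ * (4 * Real.pi ^ 2 * freqNormSq (fun i => (W.phase j).m i * (n : ℤ))))) ^ 2 * ((W.phase j).τ * (1 - 4 * W.ramp / 3)))) - 1)) ^ 2) ^ 2)
    {T : ℝ} (hT : 0 < T) {w : ℝ → UnitAddTorus (Fin 3) → EuclideanSpace ℝ (Fin 3)}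
    (hw : Torus.IsWeakPassiveVectorOn 0 T κ (W.cell n) w₀ w) :
    ∀ᵐ t ∂(volume.restrict (Ioo 0 T)), ∫ x, ‖w t x‖ ^ 2 ≤
      β * Real.exp (2 * (1 - 2 * ε) * lam * W.period) * Real.exp (-(2 * (1 - 2 * ε) * lam) * t) * ∫ x, ‖w₀ x‖ ^ 2 := by
  classical
  have hn' : (0 : ℝ) < n := by exact_mod_cast hn
  have hρ := W.ramp_pos
  have hρ2 := W.ramp_le
  have hr : 0 ≤ 1 - 4 * W.ramp / 3 := by linarith only [hρ2]
  -- frames and gap data in every slot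
  have hin := fun j : Fin k₀ => anySlot_inputs (W.phase j) hn hℓ (h4 j)
  choose ζr pf hk hdisj hζ1 hζ0 hζK hp hs hd0 hgap hd1 hdm1 using hin
  have hK0 : ∀ j : Fin k₀, (fun i => (W.phase j).m i * (n : ℤ)) ≠ 0 := fun j => cellFreq_ne_zero (W.phase j) hn
  have hKpos : ∀ j : Fin k₀, 0 < freqNormSq (fun i => (W.phase j).m i * (n : ℤ)) := fun j => by
    rw [← norm_latticeVec_sq]; have := one_le_norm_latticeVec (hK0 j); positivity
  have hℓpos : 0 < freqNormSq ℓ := by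
    rw [← norm_latticeVec_sq]; have := one_le_norm_latticeVec hℓ; positivity
  -- abbreviations
  obtain ⟨Lf, hLf⟩ : ∃ f : Fin k₀ → ℝ, f = fun j => (κ * (4 * Real.pi ^ 2 * freqNormSq (fun i => (W.phase j).m i * (n : ℤ)))) := ⟨_, rfl⟩
  have hLpos : ∀ j, 0 < Lf j := fun j => by rw [hLf]; have := hKpos j; positivity
  obtain ⟨Gf, hGf⟩ : ∃ f : Fin k₀ → ℝ, f = fun j => (2 * Real.pi * (∑ i, (W.phase j).e i * (ℓ i : ℝ)) * ‖Complex.exp ((W.phase j).φ * Complex.I) * (1 / (2 * ((2 * Real.pi * ‖latticeVec (W.phase j).m‖ : ℝ) : ℂ) * Complex.I))‖ * (1 / (n : ℝ)) / Lf j) := ⟨_, rfl⟩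
  have hGexp : ∀ j, Gf j = (2 * Real.pi * (∑ i, (W.phase j).e i * (ℓ i : ℝ)) * ‖Complex.exp ((W.phase j).φ * Complex.I) * (1 / (2 * ((2 * Real.pi * ‖latticeVec (W.phase j).m‖ : ℝ) : ℂ) * Complex.I))‖ * (1 / (n : ℝ)) / (κ * (4 * Real.pi ^ 2 * freqNormSq (fun i => (W.phase j).m i * (n : ℤ))))) := fun j => by rw [hGf, hLf]
  obtain ⟨D0f, hD0f⟩ : ∃ f : Fin k₀ → ℝ, f = fun j => (freqNormSq ℓ / freqNormSq (fun i => (W.phase j).m i * (n : ℤ))) := ⟨_, rfl⟩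
  obtain ⟨Dp, hDp⟩ : ∃ f : Fin k₀ → ℝ, f = fun j => (freqNormSq (ℓ + (1 : ℤ) • (fun i => (W.phase j).m i * (n : ℤ))) / freqNormSq (fun i => (W.phase j).m i * (n : ℤ))) := ⟨_, rfl⟩
  obtain ⟨Dm, hDm⟩ : ∃ f : Fin k₀ → ℝ, f = fun j => (freqNormSq (ℓ + (-1 : ℤ) • (fun i => (W.phase j).m i * (n : ℤ))) / freqNormSq (fun i => (W.phase j).m i * (n : ℤ))) := ⟨_, rfl⟩
  have eD0 : ∀ j, (freqNormSq ℓ / freqNormSq (fun i => (W.phase j).m i * (n : ℤ))) = D0f j := fun j => by rw [hD0f]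
  have eDp : ∀ j, (freqNormSq (ℓ + (1 : ℤ) • (fun i => (W.phase j).m i * (n : ℤ))) / freqNormSq (fun i => (W.phase j).m i * (n : ℤ))) = Dp j := fun j => by rw [hDp]
  have eDm : ∀ j, (freqNormSq (ℓ + (-1 : ℤ) • (fun i => (W.phase j).m i * (n : ℤ))) / freqNormSq (fun i => (W.phase j).m i * (n : ℤ))) = Dm j := fun j => by rw [hDm]
  have hd0nn : ∀ j, 0 ≤ D0f j := fun j => by rw [hD0f]; exact div_nonneg (freqNormSq_nonneg _) (hKpos j).le
  have hd0pos : ∀ j, 0 < D0f j := fun j => by rw [hD0f]; exact div_pos hℓpos (hKpos j)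
  have hgp' : ∀ j, D0f j + 7 / 16 ≤ Dp j := fun j => by rw [← eD0, ← eDp]; exact hgap j 1 one_ne_zero
  have hgm' : ∀ j, D0f j + 7 / 16 ≤ Dm j := fun j => by rw [← eD0, ← eDm]; exact hgap j (-1) (by norm_num)
  have hd1' : ∀ j, Dp j ≤ 2 := fun j => by rw [← eDp]; exact hd1 j
  have hdm1' : ∀ j, Dm j ≤ 2 := fun j => by rw [← eDm]; exact hdm1 j
  have hgp : ∀ j, 0 < Dp j - D0f j := fun j => by linarith only [hgp' j]
  have hgm : ∀ j, 0 < Dm j - D0f j := fun j => by linarith only [hgm' j]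
  obtain ⟨So, hSo⟩ : ∃ f : Fin k₀ → ℝ, f = fun j => 1 / (Dm j - D0f j) + 1 / (Dp j - D0f j) := ⟨_, rfl⟩
  obtain ⟨Si, hSi⟩ : ∃ f : Fin k₀ → ℝ, f = fun j =>
      (pf j (-1) ⬝ᵥ pf j 0) ^ 2 / (Dm j - D0f j) + (pf j 0 ⬝ᵥ pf j 1) ^ 2 / (Dp j - D0f j) := ⟨_, rfl⟩
  obtain ⟨Fl, hFl⟩ : ∃ f : Fin k₀ → ℝ, f = fun j => (min 2 (2 * (max ((|(fun i => ((ℓ i : ℤ) : ℝ)) ⬝ᵥ (fun i => (((fun i => (W.phase j).m i * (n : ℤ)) i : ℤ) : ℝ))| - (fun i => ((ℓ i : ℤ) : ℝ)) ⬝ᵥ (fun i => ((ℓ i : ℤ) : ℝ))) / (Real.sqrt ((fun i => ((ℓ i : ℤ) : ℝ)) ⬝ᵥ (fun i => ((ℓ i : ℤ) : ℝ))) * (Real.sqrt ((fun i => ((ℓ i : ℤ) : ℝ)) ⬝ᵥ (fun i => ((ℓ i : ℤ) : ℝ))) + Real.sqrt ((fun i => (((fun i => (W.phase j).m i * (n :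 ℤ)) i : ℤ) : ℝ)) ⬝ᵥ (fun i => (((fun i => (W.phase j).m i * (n : ℤ)) i : ℤ) : ℝ)))))) 0) ^ 2 / (1 + 2 * |(fun i => ((ℓ i : ℤ) : ℝ)) ⬝ᵥ (fun i => (((fun i => (W.phase j).m i * (n : ℤ)) i : ℤ) : ℝ))| / ((fun i => (((fun i => (W.phase j).m i * (n : ℤ)) i : ℤ) : ℝ)) ⬝ᵥ (fun i => (((fun i => (W.phase j).m i * (n : ℤ)) i : ℤ) : ℝ)))))) := ⟨_, rfl⟩
  -- the slaving weights
  have hwb : ∀ j, 1 ≤ So j ∧ So j ≤ 32 / 7 ∧ ((pf j 0 ⬝ᵥ pf j 1) ^ 2 + (pf j (-1) ⬝ᵥ pf j 0) ^ 2) / 2 ≤ Si j ∧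
      Si j ≤ 16 / 7 * ((pf j 0 ⬝ᵥ pf j 1) ^ 2 + (pf j (-1) ⬝ᵥ pf j 0) ^ 2) ∧
      (pf j 0 ⬝ᵥ pf j 1) ^ 2 + (pf j (-1) ⬝ᵥ pf j 0) ^ 2 ≤ 2 ∧ Si j ≤ 32 / 7 := by
    intro j
    have h := slaving_weight_bounds (s0 := pf j 0 ⬝ᵥ pf j 1) (sm1 := pf j (-1) ⬝ᵥ pf j 0) (hd0nn j) (hgp' j) (hgm' j)
      (hd1' j) (hdm1' j) (hs j 0) (by have := hs j (-1); rwa [show (-1 : ℤ) + 1 = 0 by norm_num] at this)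
    rw [hSo, hSi]
    exact h
  have hσo2 : ∀ j, 2 ≤ So j := fun j => by
    have h := outPlane_weight_ge_two ℓ (fun i => (W.phase j).m i * (n : ℤ)) (hK0 j) (by rw [eDp, eD0]; exact hgp j) (by rw [eDm, eD0]; exact hgm j)
    rw [eDp, eDm, eD0] at h
    rw [hSo]; exact h
  have hσifl : ∀ j, Fl j ≤ Si j := fun j => by
    have h := inPlane_weight_lower ℓ (fun i => (W.phase j).m i * (n : ℤ)) hℓ (hK0 j) (hζ1 j) (hζ0 j) (hζK j) (hp j)
      (by rw [eDp, eD0]; exact hgp j) (by rw [eDm, eD0]; exact hgm j)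
    rw [eDp, eDm, eD0] at h
    rw [hFl, hSi]
    exact (min_le_right _ _).trans h
  have hFl2 : ∀ j, Fl j ≤ 2 := fun j => by rw [hFl]; exact min_le_left _ _
  have hFl0 : ∀ j, 0 ≤ Fl j := fun j => by
    rw [hFl]
    refine le_min (by norm_num) (div_nonneg (mul_nonneg (by norm_num) (sq_nonneg _)) ?_)
    have : 0 < (fun i => (((fun i => (W.phase j).m i * (n : ℤ)) i : ℤ) : ℝ)) ⬝ᵥ (fun i => (((fun i => (W.phase j).m i * (n : ℤ)) i : ℤ) : ℝ)) := by rw [← freqNormSq_eq_dotProduct]; exact hKpos j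
    positivity
  -- nonnegativity
  have hΛ0 : ∀ j, 0 ≤ Lf j := fun j => (hLpos j).le
  have hSo0 : ∀ j, 0 ≤ So j := fun j => by linarith only [(hwb j).1]
  have hSi0 : ∀ j, 0 ≤ Si j := fun j => le_trans (by positivity) (hwb j).2.2.1
  have hGexp' : ∀ j, Gf j = (2 * Real.pi * (∑ i, (W.phase j).e i * (ℓ i : ℝ)) * ‖Complex.exp ((W.phase j).φ * Complex.I) * (1 / (2 * ((2 * Real.pi * ‖latticeVec (W.phase j).m‖ : ℝ) : ℂ) * Complex.I))‖ * (1 / (n : ℝ)) / (κ * (4 * Real.pi ^ 2 * freqNormSq (fun i => (W.phase j).m i * (n : ℤ))))) := hGexp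
  have hLf' : ∀ j, Lf j = (κ * (4 * Real.pi ^ 2 * freqNormSq (fun i => (W.phase j).m i * (n : ℤ)))) := fun j => by rw [hLf]
  -- the numeric in-plane floor `2ĉ² − 12‖ℓ‖/n ≤ σ_i`
  have ha0 : 0 < ‖latticeVec ℓ‖ := lt_of_lt_of_le one_pos (one_le_norm_latticeVec hℓ)
  have hxx := (dot_cast_facts ℓ ℓ).1
  have hσic2 : ∀ j, 2 * ((⟪latticeVec (W.phase j).m, latticeVec ℓ⟫_ℝ / (‖latticeVec (W.phase j).m‖ * ‖latticeVec ℓ‖)) ^ 2) - 12 * ‖latticeVec ℓ‖ / (n : ℝ) ≤ Si j := by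
    intro j
    have hb := (dot_cast_cellFreq ℓ (W.phase j).m n).2
    have hbm : 1 ≤ ‖latticeVec (W.phase j).m‖ := one_le_norm_latticeVec (W.phase j).m_ne
    have hb0 : 0 < ‖latticeVec (fun i => (W.phase j).m i * (n : ℤ))‖ := by rw [hb]; positivity
    have hKK := (dot_cast_facts (fun i => (W.phase j).m i * (n : ℤ)) (fun i => (W.phase j).m i * (n : ℤ))).1
    have hCS := (dot_cast_facts ℓ (fun i => (W.phase j).m i * (n : ℤ))).2.2
    have hxK : (fun i => ((ℓ i : ℤ) : ℝ)) ⬝ᵥ (fun i => (((fun i => (W.phase j).m i * (n : ℤ)) i : ℤ) : ℝ)) = (n : ℝ) * ⟪latticeVec (W.phase j).m, latticeVec ℓ⟫_ℝ := by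
      rw [(dot_cast_cellFreq ℓ (W.phase j).m n).1, Literature.Algebra.EuclideanLattices.inner_fin_three]
      simp only [latticeVec_apply]
      ring
    have hfl := inPlane_floor_defect ha0 hb0 (abs_nonneg ((fun i => ((ℓ i : ℤ) : ℝ)) ⬝ᵥ (fun i => (((fun i => (W.phase j).m i * (n : ℤ)) i : ℤ) : ℝ)))) hCS (h4 j)
    have hFlge : 2 * (|(fun i => ((ℓ i : ℤ) : ℝ)) ⬝ᵥ (fun i => (((fun i => (W.phase j).m i * (n : ℤ)) i : ℤ) : ℝ))| / (‖latticeVec ℓ‖ * ‖latticeVec (fun i => (W.phase j).m i * (n : ℤ))‖)) ^ 2 - 12 * (‖latticeVec ℓ‖ / ‖latticeVec (fun i => (W.phase j).m i * (n : ℤ))‖) ≤ Fl j := by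
      rw [hFl]
      simp only []
      rw [hxx, hKK, Real.sqrt_sq ha0.le, Real.sqrt_sq hb0.le]
      refine le_min ?_ hfl
      have hc1 : (|(fun i => ((ℓ i : ℤ) : ℝ)) ⬝ᵥ (fun i => (((fun i => (W.phase j).m i * (n : ℤ)) i : ℤ) : ℝ))| / (‖latticeVec ℓ‖ * ‖latticeVec (fun i => (W.phase j).m i * (n : ℤ))‖)) ^ 2 ≤ 1 := by
        rw [div_pow, div_le_one (by positivity)]
        exact pow_le_pow_left₀ (abs_nonneg _) hCS 2
      have : 0 ≤ 12 * (‖latticeVec ℓ‖ / ‖latticeVec (fun i => (W.phase j).m i * (n : ℤ))‖) := by positivity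
      linarith
    have hc2 : (|(fun i => ((ℓ i : ℤ) : ℝ)) ⬝ᵥ (fun i => (((fun i => (W.phase j).m i * (n : ℤ)) i : ℤ) : ℝ))| / (‖latticeVec ℓ‖ * ‖latticeVec (fun i => (W.phase j).m i * (n : ℤ))‖)) ^ 2 = ((⟪latticeVec (W.phase j).m, latticeVec ℓ⟫_ℝ / (‖latticeVec (W.phase j).m‖ * ‖latticeVec ℓ‖)) ^ 2) := by
      rw [div_pow, sq_abs, hxK, hb, div_pow]
      field_simp
    have hdef : 12 * (‖latticeVec ℓ‖ / ‖latticeVec (fun i => (W.phase j).m i * (n : ℤ))‖) ≤ 12 * ‖latticeVec ℓ‖ / (n : ℝ) := by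
      rw [hb, mul_div_assoc]
      refine le_of_eq_of_le rfl (mul_le_mul_of_nonneg_left ?_ (by norm_num))
      exact div_le_div_of_nonneg_left ha0.le hn' (le_mul_of_one_le_right hn'.le hbm)
    rw [hc2] at hFlge
    linarith [hFlge, hσifl j]
  -- the frames are orthogonal to `m_j`
  have hζm : ∀ j, ζr j ⬝ᵥ (fun i => (((W.phase j).m i : ℤ) : ℝ)) = 0 := by
    intro j
    have h := hζK j
    have e : (fun i => (((fun i => (W.phase j).m i * (n : ℤ)) i : ℤ) : ℝ)) = (n : ℝ) • (fun i => (((W.phase j).m i : ℤ) : ℝ)) := by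
      funext i; simp [mul_comm]
    rw [e, dotProduct_smul, smul_eq_mul] at h
    rcases mul_eq_zero.1 h with h | h
    · exact absurd h hn'.ne'
    · exact h
  -- the isotropy bound `μ`
  have hsj : ∀ j, Lf j * (W.phase j).τ * Gf j ^ 2 = 2 * Real.pi ^ 2 / (κ * (n : ℝ) ^ 4) *
      ((W.phase j).τ * (1 / (2 * (2 * Real.pi * ‖latticeVec (W.phase j).m‖) ^ 4)) * (∑ i, (W.phase j).e i * (ℓ i : ℝ)) ^ 2) := by
    intro j
    rw [hGexp' j, hLf' j]
    exact slot_exponent_eq_slotWeight (W.phase j) hn hκ _ _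
  have hGid : ∀ z₁ z₂ : ℝ, ∑ j, Lf j * (W.phase j).τ * Gf j ^ 2 *
      (((ζr ⟨0, W.pos⟩ ⬝ᵥ ζr j) * z₁ + ((((Real.sqrt ((fun i => ((ℓ i : ℤ) : ℝ)) ⬝ᵥ (fun i => ((ℓ i : ℤ) : ℝ))))⁻¹ • (fun i => ((ℓ i : ℤ) : ℝ))) ⨯₃ ζr ⟨0, W.pos⟩) ⬝ᵥ ζr j) * z₂) ^ 2 + ((⟪latticeVec (W.phase j).m, latticeVec ℓ⟫_ℝ / (‖latticeVec (W.phase j).m‖ * ‖latticeVec ℓ‖)) ^ 2) * (-((((Real.sqrt ((fun i => ((ℓ i : ℤ) : ℝ)) ⬝ᵥ (fun i => ((ℓ i : ℤ) : ℝ))))⁻¹ • (fun i => ((ℓ i : ℤ) : ℝ))) ⨯₃ ζr ⟨0, W.pos⟩) ⬝ᵥ ζr j) * z₁ + (ζr ⟨0, W.pos⟩ ⬝ᵥ ζr j) * z₂) ^ 2) = (2 * Real.pi ^ 2 / (κ * (n : ℝ) ^ 4) * (c₀ * W.period * ‖latticeVec ℓ‖ ^ 2)) * (z₁ ^ 2 +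 z₂ ^ 2) := by
    intro z₁ z₂
    have h := iso_isotropy_sum_word hW ℓ hℓ ζr hζ1 hζ0 hζm ⟨0, W.pos⟩ z₁ z₂
    simp only [hsj]
    rw [show (∑ j : Fin k₀, 2 * Real.pi ^ 2 / (κ * (n : ℝ) ^ 4) *
        ((W.phase j).τ * (1 / (2 * (2 * Real.pi * ‖latticeVec (W.phase j).m‖) ^ 4)) * (∑ i, (W.phase j).e i * (ℓ i : ℝ)) ^ 2) *
        (((ζr ⟨0, W.pos⟩ ⬝ᵥ ζr j) * z₁ + ((((Real.sqrt ((fun i => ((ℓ i : ℤ) : ℝ)) ⬝ᵥ (fun i => ((ℓ i : ℤ) : ℝ))))⁻¹ • (fun i => ((ℓ i : ℤ) : ℝ))) ⨯₃ ζr ⟨0, W.pos⟩) ⬝ᵥ ζr j) * z₂) ^ 2 + ((⟪latticeVec (W.phase j).m, latticeVec ℓ⟫_ℝ / (‖latticeVec (W.phase j).m‖ * ‖latticeVec ℓ‖)) ^ 2) * (-((((Real.sqrt ((fun i => ((ℓ i : ℤ) : ℝ)) ⬝ᵥ (fun i => ((ℓ i : ℤ) : ℝ))))⁻¹ • (fun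 i => ((ℓ i : ℤ) : ℝ))) ⨯₃ ζr ⟨0, W.pos⟩) ⬝ᵥ ζr j) * z₁ + (ζr ⟨0, W.pos⟩ ⬝ᵥ ζr j) * z₂) ^ 2)) =
        2 * Real.pi ^ 2 / (κ * (n : ℝ) ^ 4) * ∑ j : Fin k₀, ((W.phase j).τ * (1 / (2 * (2 * Real.pi * ‖latticeVec (W.phase j).m‖) ^ 4)) *
        (∑ i, (W.phase j).e i * (ℓ i : ℝ)) ^ 2 * (((ζr ⟨0, W.pos⟩ ⬝ᵥ ζr j) * z₁ + ((((Real.sqrt ((fun i => ((ℓ i : ℤ) : ℝ)) ⬝ᵥ (fun i => ((ℓ i : ℤ) : ℝ))))⁻¹ • (fun i => ((ℓ i : ℤ) : ℝ))) ⨯₃ ζr ⟨0, W.pos⟩) ⬝ᵥ ζr j) * z₂) ^ 2 + ((⟪latticeVec (W.phase j).m, latticeVec ℓ⟫_ℝ / (‖latticeVec (W.phase j).m‖ * ‖latticeVec ℓ‖)) ^ 2) * (-((((Real.sqrt ((fun i => ((ℓ i : ℤ) : ℝ)) ⬝ᵥ (fun i => ((ℓ i : ℤ) : ℝ))))⁻¹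 • (fun i => ((ℓ i : ℤ) : ℝ))) ⨯₃ ζr ⟨0, W.pos⟩) ⬝ᵥ ζr j) * z₁ + (ζr ⟨0, W.pos⟩ ⬝ᵥ ζr j) * z₂) ^ 2)) by
      rw [Finset.mul_sum]; exact Finset.sum_congr rfl (fun j _ => by ring), h]
    ring
  have hrot : ∀ j, (ζr ⟨0, W.pos⟩ ⬝ᵥ ζr j) ^ 2 + ((((Real.sqrt ((fun i => ((ℓ i : ℤ) : ℝ)) ⬝ᵥ (fun i => ((ℓ i : ℤ) : ℝ))))⁻¹ • (fun i => ((ℓ i : ℤ) : ℝ))) ⨯₃ ζr ⟨0, W.pos⟩) ⬝ᵥ ζr j) ^ 2 = 1 := fun j =>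
    (frame_bridge_inner hℓ (hζ1 ⟨0, W.pos⟩) (hζ0 ⟨0, W.pos⟩) (hζ1 j) (hζ0 j) 0).2.2
  have hiso := iso_mu_lower Lf (fun j => (freqNormSq ℓ / freqNormSq (fun i => (W.phase j).m i * (n : ℤ)))) (fun j => (W.phase j).τ) So Si Gf (fun j => Lf j * (W.phase j).τ * Gf j ^ 2)
    (fun j => ((⟪latticeVec (W.phase j).m, latticeVec ℓ⟫_ℝ / (‖latticeVec (W.phase j).m‖ * ‖latticeVec ℓ‖)) ^ 2)) (fun j => (ζr ⟨0, W.pos⟩ ⬝ᵥ ζr j)) (fun j => ((((Real.sqrt ((fun i => ((ℓ i : ℤ) : ℝ)) ⬝ᵥ (fun i => ((ℓ i : ℤ) : ℝ))))⁻¹ • (fun i => ((ℓ i : ℤ) : ℝ))) ⨯₃ ζr ⟨0, W.pos⟩) ⬝ᵥ ζr j)) (r := (1 - 4 * W.ramp / 3)) (Cs := 1) (G := (2 * Real.pi ^ 2 / (κ * (n : ℝ) ^ 4) * (c₀ * W.period * ‖latticeVec ℓ‖ ^ 2)))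
    (D := 12 * ‖latticeVec ℓ‖ / (n : ℝ)) hr zero_le_one (by positivity) hrot (fun j => (one_mul _).symm)
    (fun j => by have := (W.phase j).τ_pos; have := hΛ0 j; positivity) hσo2 hσic2 hGid
  -- the frame-dependent exponents are below the frame-free ones
  have hXY : ∀ j, (Lf j * ((freqNormSq ℓ / freqNormSq (fun i => (W.phase j).m i * (n : ℤ))) * (W.phase j).τ + So j * Gf j ^ 2 * ((W.phase j).τ * (1 - 4 * W.ramp / 3)))) + (Lf j * ((freqNormSq ℓ / freqNormSq (fun i => (W.phase j).m i * (n : ℤ))) * (W.phase j).τ + Si j * Gf j ^ 2 * ((W.phase j).τ * (1 - 4 * W.ramp / 3)))) ≤ (Lf j * ((freqNormSq ℓ / freqNormSq (fun i => (W.phase j).m i * (n : ℤ))) * (W.phase j).τ + 32 / 7 * Gf j ^ 2 * ((W.phase j).τ * (1 - 4 * W.ramp / 3))) + Lf j * ((freqNormSq ℓ / freqNormSq (fun i => (W.phase j).m i * (n : ℤ))) * (W.phase j).τ + 32 / 7 * Gf j ^ 2 * ((W.phase j).τ * (1 - 4 * W.ramp / 3)))) := by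
    intro j
    have hτ := (W.phase j).τ_pos
    have h1 : So j ≤ 32 / 7 := (hwb j).2.1
    have h2 : Si j ≤ 32 / 7 := (hwb j).2.2.2.2.2
    have hc : 0 ≤ Lf j * (Gf j ^ 2 * ((W.phase j).τ * (1 - 4 * W.ramp / 3))) := mul_nonneg (hΛ0 j) (mul_nonneg (sq_nonneg _) (mul_nonneg hτ.le hr))
    nlinarith only [mul_le_mul_of_nonneg_left h1 hc, mul_le_mul_of_nonneg_left h2 hc]
  have hSXY : (∑ j, (Real.exp ((Lf j * ((freqNormSq ℓ / freqNormSq (fun i => (W.phase j).m i * (n : ℤ))) * (W.phase j).τ + So j * Gf j ^ 2 * ((W.phase j).τ * (1 - 4 * W.ramp / 3)))) + (Lf j * ((freqNormSq ℓ / freqNormSq (fun i => (W.phase j).m i * (n : ℤ))) * (W.phase j).τ + Si j * Gf j ^ 2 * ((W.phase j).τ * (1 - 4 * W.ramp / 3))))) - 1)) ≤ ∑ j, (Real.exp (Lf j * ((freqNormSq ℓ / freqNormSq (fun i => (W.phase j).m i * (n : ℤ))) * (W.phase j).τ + 32 / 7 * Gf j ^ 2 * ((W.phase j).τ * (1 -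 4 * W.ramp / 3))) + Lf j * ((freqNormSq ℓ / freqNormSq (fun i => (W.phase j).m i * (n : ℤ))) * (W.phase j).τ + 32 / 7 * Gf j ^ 2 * ((W.phase j).τ * (1 - 4 * W.ramp / 3)))) - 1) :=
    Finset.sum_le_sum fun j _ => by linarith only [Real.exp_le_exp.2 (hXY j)]
  have hS0 : 0 ≤ ∑ j, (Real.exp ((Lf j * ((freqNormSq ℓ / freqNormSq (fun i => (W.phase j).m i * (n : ℤ))) * (W.phase j).τ + So j * Gf j ^ 2 * ((W.phase j).τ * (1 - 4 * W.ramp / 3)))) + (Lf j * ((freqNormSq ℓ / freqNormSq (fun i => (W.phase j).m i * (n : ℤ))) * (W.phase j).τ + Si j * Gf j ^ 2 * ((W.phase j).τ * (1 - 4 * W.ramp / 3))))) - 1) := Finset.sum_nonneg fun j _ => by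
    have : 0 ≤ (Lf j * ((freqNormSq ℓ / freqNormSq (fun i => (W.phase j).m i * (n : ℤ))) * (W.phase j).τ + So j * Gf j ^ 2 * ((W.phase j).τ * (1 - 4 * W.ramp / 3)))) + (Lf j * ((freqNormSq ℓ / freqNormSq (fun i => (W.phase j).m i * (n : ℤ))) * (W.phase j).τ + Si j * Gf j ^ 2 * ((W.phase j).τ * (1 - 4 * W.ramp / 3)))) := by
      have hτ := (W.phase j).τ_pos
      have := hΛ0 j; have := hSo0 j; have := hSi0 j; have := hd0nn j; rw [hD0f] at *
      positivity
    linarith only [Real.add_one_le_exp ((Lf j * ((freqNormSq ℓ / freqNormSq (fun i => (W.phase j).m i * (n : ℤ))) * (W.phase j).τ + So j * Gf j ^ 2 * ((W.phase j).τ * (1 - 4 * W.ramp / 3)))) + (Lf j * ((freqNormSq ℓ / freqNormSq (fun i => (W.phase j).m i * (n : ℤ))) * (W.phase j).τ + Si j * Gf j ^ 2 * ((W.phase j).τ * (1 - 4 * W.ramp / 3))))), this]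
  -- literal ↔ function conversions
  have eY : (∑ j, (Real.exp (Lf j * ((freqNormSq ℓ / freqNormSq (fun i => (W.phase j).m i * (n : ℤ))) * (W.phase j).τ + 32 / 7 * Gf j ^ 2 * ((W.phase j).τ * (1 - 4 * W.ramp / 3))) + Lf j * ((freqNormSq ℓ / freqNormSq (fun i => (W.phase j).m i * (n : ℤ))) * (W.phase j).τ + 32 / 7 * Gf j ^ 2 * ((W.phase j).τ * (1 - 4 * W.ramp / 3)))) - 1)) = (∑ j : Fin k₀, (Real.exp ((κ * (4 * Real.pi ^ 2 * freqNormSq (fun i => (W.phase j).m i * (n : ℤ)))) * ((freqNormSq ℓ / freqNormSq (fun i => (W.phase j).m i * (n : ℤ))) * (W.phase j).τ + 32 / 7 * (2 * Real.pi * (∑ i, (W.phase j).e i * (ℓ i : ℝ)) * ‖Complex.exp ((W.phase j).φ * Complex.I) * (1 / (2 * ((2 * Real.pi * ‖latticeVec (W.phase j).m‖ : ℝ) : ℂ) * Complex.I))‖ * (1 / (n : ℝ)) / (κ * (4 * Real.pi ^ 2 * freqNormSq (fun i => (W.phase j).m i * (n : ℤ))))) ^ 2 * ((W.phase j).τ *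 (1 - 4 * W.ramp / 3))) + (κ * (4 * Real.pi ^ 2 * freqNormSq (fun i => (W.phase j).m i * (n : ℤ)))) * ((freqNormSq ℓ / freqNormSq (fun i => (W.phase j).m i * (n : ℤ))) * (W.phase j).τ + 32 / 7 * (2 * Real.pi * (∑ i, (W.phase j).e i * (ℓ i : ℝ)) * ‖Complex.exp ((W.phase j).φ * Complex.I) * (1 / (2 * ((2 * Real.pi * ‖latticeVec (W.phase j).m‖ : ℝ) : ℂ) * Complex.I))‖ * (1 / (n : ℝ)) / (κ * (4 * Real.pi ^ 2 * freqNormSq (fun i => (W.phase j).m i * (n : ℤ))))) ^ 2 * ((W.phase j).τ * (1 - 4 * W.ramp / 3)))) - 1)) := by simp only [hGexp', hLf']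
  have eSUMY : (∑ j : Fin k₀, (Lf j * ((freqNormSq ℓ / freqNormSq (fun i => (W.phase j).m i * (n : ℤ))) * (W.phase j).τ + 32 / 7 * Gf j ^ 2 * ((W.phase j).τ * (1 - 4 * W.ramp / 3))) + Lf j * ((freqNormSq ℓ / freqNormSq (fun i => (W.phase j).m i * (n : ℤ))) * (W.phase j).τ + 32 / 7 * Gf j ^ 2 * ((W.phase j).τ * (1 - 4 * W.ramp / 3))))) = (∑ j : Fin k₀, ((κ * (4 * Real.pi ^ 2 * freqNormSq (fun i => (W.phase j).m i * (n : ℤ)))) * ((freqNormSq ℓ / freqNormSq (fun i => (W.phase j).m i * (n : ℤ))) * (W.phase j).τ + 32 / 7 * (2 * Real.pi * (∑ i, (W.phase j).e i * (ℓ i : ℝ)) * ‖Complex.exp ((W.phase j).φ * Complex.I) * (1 / (2 * ((2 * Real.pi * ‖latticeVec (W.phase j).m‖ : ℝ) : ℂ) * Complex.I))‖ * (1 / (n : ℝ)) / (κ * (4 * Real.pi ^ 2 * freqNormSq (fun i => (W.phase j).m i * (n : ℤ))))) ^ 2 * ((W.phase j).τ * (1 - 4 * W.ramp / 3))) + (κ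 * (4 * Real.pi ^ 2 * freqNormSq (fun i => (W.phase j).m i * (n : ℤ)))) * ((freqNormSq ℓ / freqNormSq (fun i => (W.phase j).m i * (n : ℤ))) * (W.phase j).τ + 32 / 7 * (2 * Real.pi * (∑ i, (W.phase j).e i * (ℓ i : ℝ)) * ‖Complex.exp ((W.phase j).φ * Complex.I) * (1 / (2 * ((2 * Real.pi * ‖latticeVec (W.phase j).m‖ : ℝ) : ℂ) * Complex.I))‖ * (1 / (n : ℝ)) / (κ * (4 * Real.pi ^ 2 * freqNormSq (fun i => (W.phase j).m i * (n : ℤ))))) ^ 2 * ((W.phase j).τ * (1 - 4 * W.ramp / 3))))) := by simp only [hGexp', hLf']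
  have eMU : ((∑ j : Fin k₀, Lf j * (freqNormSq ℓ / freqNormSq (fun i => (W.phase j).m i * (n : ℤ))) * (W.phase j).τ) + (1 - 4 * W.ramp / 3) * 1 * (2 * (2 * Real.pi ^ 2 / (κ * (n : ℝ) ^ 4) * (c₀ * W.period * ‖latticeVec ℓ‖ ^ 2)) - 12 * ‖latticeVec ℓ‖ / (n : ℝ) *
      ∑ j : Fin k₀, Lf j * (W.phase j).τ * Gf j ^ 2)) = ((∑ j : Fin k₀, (κ * (4 * Real.pi ^ 2 * freqNormSq (fun i => (W.phase j).m i * (n : ℤ)))) * (freqNormSq ℓ / freqNormSq (fun i => (W.phase j).m i * (n : ℤ))) * (W.phase j).τ) + (1 - 4 * W.ramp / 3) * 1 * (2 * (2 * Real.pi ^ 2 / (κ * (n : ℝ) ^ 4) * (c₀ * W.period * ‖latticeVec ℓ‖ ^ 2)) - 12 * ‖latticeVec ℓ‖ / (n : ℝ) * ∑ j : Fin k₀, ((κ * (4 * Real.pi ^ 2 * freqNormSq (fun i => (W.phase j).m i * (n : ℤ)))) * (W.phase j).τ * (2 * Real.pi * (∑ i, (W.phase j).e i * (ℓ i : ℝ))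 * ‖Complex.exp ((W.phase j).φ * Complex.I) * (1 / (2 * ((2 * Real.pi * ‖latticeVec (W.phase j).m‖ : ℝ) : ℂ) * Complex.I))‖ * (1 / (n : ℝ)) / (κ * (4 * Real.pi ^ 2 * freqNormSq (fun i => (W.phase j).m i * (n : ℤ))))) ^ 2))) := by simp only [hGexp', hLf']
  have hSY' := hSY
  rw [← eY] at hSY'
  have hsmallX : (∑ j, (Real.exp ((Lf j * ((freqNormSq ℓ / freqNormSq (fun i => (W.phase j).m i * (n : ℤ))) * (W.phase j).τ + So j * Gf j ^ 2 * ((W.phase j).τ * (1 - 4 * W.ramp / 3)))) + (Lf j * ((freqNormSq ℓ / freqNormSq (fun i => (W.phase j).m i * (n : ℤ))) * (W.phase j).τ + Si j * Gf j ^ 2 * ((W.phase j).τ * (1 - 4 * W.ramp / 3))))) - 1)) ≤ 1 := hSXY.trans hSY'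
  have hposY' := hposY
  rw [← eY, ← eMU] at hposY'
  have hlamY' := hlamY
  rw [← eY, ← eMU] at hlamY'
  have hsq : (∑ j, (Real.exp ((Lf j * ((freqNormSq ℓ / freqNormSq (fun i => (W.phase j).m i * (n : ℤ))) * (W.phase j).τ + So j * Gf j ^ 2 * ((W.phase j).τ * (1 - 4 * W.ramp / 3)))) + (Lf j * ((freqNormSq ℓ / freqNormSq (fun i => (W.phase j).m i * (n : ℤ))) * (W.phase j).τ + Si j * Gf j ^ 2 * ((W.phase j).τ * (1 - 4 * W.ramp / 3))))) - 1)) ^ 2 ≤ (∑ j, (Real.exp (Lf j * ((freqNormSq ℓ / freqNormSq (fun i => (W.phase j).m i * (n : ℤ))) * (W.phase j).τ + 32 / 7 * Gf j ^ 2 * ((W.phase j).τ * (1 - 4 * W.ramp / 3))) + Lf j * ((freqNormSq ℓ / freqNormSq (fun i => (W.phase j).m i * (n : ℤ))) * (W.phase j).τ + 32 / 7 * Gf j ^ 2 * ((W.phase j).τ * (1 - 4 * W.ramp / 3)))) - 1)) ^ 2 :=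
    pow_le_pow_left₀ hS0 hSXY 2
  have hdec := isoSector_decay_comoving W hn hκ ℓ hℓn hw₀ hdiv hmean hsupp hk hdisj ζr hζ1 hζ0 hζK pf hp hs hℓ
    Lf So Si (fun _ => 32 / 7) Gf (7 / 16) ε β lam _
    (fun j => by rw [hLf]) (by norm_num) hε hε2 hβ hlam hΛ0 hSo0 hSi0 hgap
    (fun j => by rw [hSo, eDm, eDp, eD0]) (fun j => by rw [hSi, eDm, eDp, eD0]) (fun j => by rw [hGf])
    (fun j => (hwb j).2.1) (fun j => (hwb j).2.2.2.2.2)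
    (fun j => by
      have h := hβ' j
      rw [← eSUMY, ← hGexp' j, ← hLf' j] at h
      have hmono : Real.exp (4 * ∑ j, ((Lf j * ((freqNormSq ℓ / freqNormSq (fun i => (W.phase j).m i * (n : ℤ))) * (W.phase j).τ + So j * Gf j ^ 2 * ((W.phase j).τ * (1 - 4 * W.ramp / 3)))) + (Lf j * ((freqNormSq ℓ / freqNormSq (fun i => (W.phase j).m i * (n : ℤ))) * (W.phase j).τ + Si j * Gf j ^ 2 * ((W.phase j).τ * (1 - 4 * W.ramp / 3)))))) ≤ Real.exp (4 * ∑ j : Fin k₀, (Lf j * ((freqNormSq ℓ / freqNormSq (fun i => (W.phase j).m i * (n : ℤ))) * (W.phase j).τ + 32 / 7 * Gf j ^ 2 * ((W.phase j).τ * (1 - 4 * W.ramp / 3))) + Lf j * ((freqNormSq ℓ / freqNormSq (fun i => (W.phase j).m i * (n : ℤ))) * (W.phase j).τ + 32 / 7 * Gf j ^ 2 * ((W.phase j).τ * (1 - 4 * W.ramp / 3))))) :=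
        Real.exp_le_exp.2 (by linarith only [Finset.sum_le_sum fun j (_ : j ∈ Finset.univ) => hXY j])
      have hnn : 0 ≤ 16 * Gf j ^ 2 * Lf j * 2 := by have := hΛ0 j; positivity
      have := mul_le_mul_of_nonneg_left (pow_le_pow_left₀ (Real.exp_pos _).le hmono 2) hnn
      nlinarith only [h, this])
    (fun j => by rw [hGexp' j, hLf' j]; exact hsmall j)
    (fun j => by rw [hGexp' j, hLf' j]; exact hJ j) hF hiso hsmallX
    (by nlinarith only [hposY', hsq]) (le_trans hlamY' (by nlinarith only [hsq, hposY', hS0]))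
    hT hw
  exact hdec

end Summit.AnomalousDissipation.AnomalousDissipation.Theorems.SolenoidalFractalHomogenisation.RealisedQuasiStaticCellLaw

end
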